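import Summits.QuantumFields.YangMills.Theorems.ConvexGribovBodyStrongCouplingShape
import HarnessLib

/-!
# Line `Sketch` of crux `ContinuumLegGivenGap` (stmt-QuantumFields-8782): the β-UNIFORM clustering
shape holds at strong coupling (calibration of `UniformOnCompacts`)

Support lemma for the open core `stub_uniformOnCompacts` of line `Sketch` ("H uniformly on bounded
coupling intervals"): in the one regime where clustering is a theorem — Osterwalder–Seiler strong
coupling, `0 ≤ β ≤ betaOne 4 r.ρ / 4` — the clustering constants delivered by the tree's
`abs_latticeConnectedCorr_le` (torus analyticity bound behind item stmt-QuantumFields-8783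
`StrongCouplingShape`) are ALREADY uniform in `β` on the whole strong-coupling interval, with one
rate `log 2` and per-pair constants depending on the pair only through `‖A‖∞, ‖B‖∞`, the support
sizes and the time extent of the supports. So the SHAPE asked by `UniformOnCompacts` (one rate and
β-uniform per-pair constants on a bounded coupling interval) is the shape in which clustering is
actually proved; what is open is only its validity on the weak-coupling tail. Nothing posited, no
`def`; a reordering of the quantifiers of `strongCouplingShape_proof`. [folklore]
-/

noncomputable section

open MeasureTheory Filter Topology Finset
open Literature.MathematicalPhysics.QuantumFieldTheory

namespace Summit.QuantumFields.YangMills.Theorems.ContinuumLegGivenGap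

/-- **β-uniform clustering shape at strong coupling.** For every compact group `G` with a lattice
representation `r` there are `b = betaOne 4 r.ρ / 4 > 0` and the rate `μ = log 2` such that every
pair of gauge-invariant local observables `A, B` has ONE constant `C(A, B)` with
`|latticeConnectedCorr r.ρ β (2S+1) A.F B.F n| ≤ C e^{-μ n}` for ALL `β ∈ [0, b]`, all `S` and all
`n ≤ S` (Osterwalder–Seiler 1978, Thm. 3.5, via the tree's `abs_latticeConnectedCorr_le`). [folklore] -/
theorem uniformShape_strongCoupling :
    ∀ (G : Type) [Group G] [TopologicalSpace G] [IsTopologicalGroup G] [CompactSpace G]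
      [MeasurableSpace G] [BorelSpace G] (r : LatticeRep G),
      ∃ b : ℝ, 0 < b ∧ ∃ μ : ℝ, 0 < μ ∧ ∀ A B : YMSpecies G, ∃ C : ℝ, ∀ β : ℝ, 0 ≤ β → β ≤ b →
        ∀ S n : ℕ, n ≤ S →
          |latticeConnectedCorr r.ρ β (2 * S + 1) A.F B.F n| ≤ C * Real.exp (-(μ * n)) := by
  -- adapted from `Summit.QuantumFields.YangMills.Theorems.strongCouplingShape_proof`
  intro G _ _ _ _ _ _ r
  have hb : 0 < betaOne 4 r.ρ := betaOne_pos 4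
  refine ⟨betaOne 4 r.ρ / 4, by positivity, Real.log 2, Real.log_pos one_lt_two, fun A B => ?_⟩
  obtain ⟨C_A, hA⟩ := A.bounded
  obtain ⟨C_B, hB⟩ := B.bounded
  set r₀ : ℕ := (A.supp ∪ B.supp).sup fun e => (e.1 0).natAbs with hr₀
  have hrA : ∀ e ∈ A.supp, (e.1 0).natAbs ≤ r₀ := fun e he =>
    Finset.le_sup (f := fun e : ZdEdge 4 => (e.1 0).natAbs) (Finset.mem_union_left _ he)
  have hrB : ∀ e ∈ B.supp, (e.1 0).natAbs ≤ r₀ := fun e he =>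
    Finset.le_sup (f := fun e : ZdEdge 4 => (e.1 0).natAbs) (Finset.mem_union_right _ he)
  obtain ⟨K, hK⟩ : ∃ K : ℝ, K = 2 * C_A * C_B * (2 * Real.exp (1 / 2)) ^
      (2 * ((A.supp.card + B.supp.card) * (2 ^ 4 * (4 * 4)))) := ⟨_, rfl⟩
  have hC_A : 0 ≤ C_A := (abs_nonneg _).trans (hA fun _ => 1)
  have hC_B : 0 ≤ C_B := (abs_nonneg _).trans (hB fun _ => 1)
  have hK0 : 0 ≤ K := by rw [hK]; positivity
  refine ⟨K * 2 ^ (2 * r₀), fun β hβ0 hβ S n hn => ?_⟩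
  have h := abs_latticeConnectedCorr_le r.continuous A B hA hB hrA hrB hβ0 hβ S n hn
  rw [← hK] at h
  -- `(1/2)^(n - 2r₀) ≤ 2^(2r₀) e^{-(log 2) n}`
  have hexp : Real.exp (-(Real.log 2 * n)) = ((2 : ℝ) ^ n)⁻¹ := by
    rw [Real.exp_neg, mul_comm, Real.exp_nat_mul, Real.exp_log two_pos]
  have hmain : ((1 : ℝ) / 2) ^ (n - 2 * r₀) ≤ 2 ^ (2 * r₀) * ((2 : ℝ) ^ n)⁻¹ := by
    rw [le_mul_inv_iff₀ (by positivity)]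
    have h2n : (2 : ℝ) ^ n ≤ 2 ^ (n - 2 * r₀) * 2 ^ (2 * r₀) := by
      rw [← pow_add]; exact pow_le_pow_right₀ one_le_two (by omega)
    have hone : ((1 : ℝ) / 2) ^ (n - 2 * r₀) * 2 ^ (n - 2 * r₀) = 1 := by
      rw [← mul_pow]; norm_num
    calc ((1 : ℝ) / 2) ^ (n - 2 * r₀) * 2 ^ n
        ≤ ((1 : ℝ) / 2) ^ (n - 2 * r₀) * (2 ^ (n - 2 * r₀) * 2 ^ (2 * r₀)) :=
          mul_le_mul_of_nonneg_left h2n (by positivity)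
      _ = 2 ^ (2 * r₀) := by rw [← mul_assoc, hone, one_mul]
  calc |latticeConnectedCorr r.ρ β (2 * S + 1) A.F B.F n| ≤ K * (1 / 2) ^ (n - 2 * r₀) := h
    _ ≤ K * (2 ^ (2 * r₀) * ((2 : ℝ) ^ n)⁻¹) := mul_le_mul_of_nonneg_left hmain hK0
    _ = K * 2 ^ (2 * r₀) * Real.exp (-(Real.log 2 * n)) := by rw [hexp]; ring

end Summit.QuantumFields.YangMills.Theorems.ContinuumLegGivenGap

end
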